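import Literature.NumberTheory.Transcendental.AssociatorsEval
import HarnessLib

/-!
# Substitution endomorphisms and the reverse-and-relabel anti-involution of `R⟨⟨A⟩⟩`

Definition file (Literature, `NumberTheory/Transcendental`), written for route
KontsevichZagierPeriods/FurushoPentagon (support item `DoubleShuffleInKZ`, stmt-14665: the reduction
of the regularised double shuffle relations to OHNO's relations + duality after
[IharaKanekoZagier2006, §4–§6], whose automorphisms `Δ_u`, `σ`, `σ̄` of `𝔥 = ℚ⟨x,y⟩` are
substitutions and whose duality `τ` is the reverse-and-relabel anti-involution; the letter images
are in the sibling file `IKZAutomorphisms.lean`).  Definitions + fully proved API; no named fact.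

## Contents

1. `NCSeries.subst f φ` — the **continuous algebra endomorphism of the completed free algebra**
   `R⟨⟨A⟩⟩ = NCSeries A R` (concatenation product) **given by substituting a series `f a` for each
   letter `a`** [Reutenauer1993, §1.4]: coefficientwise it is the tree's weight-truncated
   substitution `NCSeries.evalTrunc` (Associators.lean) read in weight `|u|`,
   `c_u(subst f φ) = c_u(evalTrunc |u| f φ) = Σ_{|w| ≤ |u|} c_w(φ) c_u(f(w₁) ⋯ f(w_k))`.
   It is additive, `R`-linear, unital, sends monomials to products of letter images, and — when
   the `f a` have no constant term — MULTIPLICATIVE (`NCSeries.subst_mul`, through the truncated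
   algebras `R⟨⟨A⟩⟩/(deg > N)`, where `evalTrunc` is an algebra map: `NCSeries.evalTrunc_mul`),
   and truncation-continuous (`NCSeries.subst_apply_congr`).
2. Coefficient formulas for left/right multiplication by a letter (`letter_mul_apply_cons`,
   `mul_letter_apply`).
3. `NCSeries.dualSeries e φ` — "reverse the word and relabel the letters by `e`":
   `c_v(dualSeries e φ) = c_{e(v) reversed}(φ)`, an anti-endomorphism (`dualSeries_mul`); for
   `A = Bool`, `e = not` it is the **duality involution `τ`** of [IharaKanekoZagier2006, §6]
   (`x ↔ y`, order reversed), with `binaryWord (MZV.dual s) = τ(binaryWord s)` (`MZV.binaryWord_dual`).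

## Deliberately NOT here

Composition of substitutions as a substitution and `subst` as a bundled `RingHom` (not needed by
the route: identities of substitutions are checked on monomials by multiplicativity); Mathlib has
substitution only for COMMUTATIVE power series (`MvPowerSeries.subst`), nothing for `FreeAlgebra`
completions (checked 2026-08-16).

## References

* C. Reutenauer, *Free Lie Algebras*, Oxford (1993), §1.4 (continuous endomorphisms of `K⟨⟨A⟩⟩`
  are the substitutions). [Reutenauer1993]
* K. Ihara, M. Kaneko, D. Zagier, *Derivation and double shuffle relations for multiple zeta
  values*, Compositio Math. 142 (2006) 307–338, §6 (the anti-automorphism `τ`).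
  [IharaKanekoZagier2006]
-/

noncomputable section

open scoped BigOperators

namespace Literature.NumberTheory.Transcendental

universe u v

namespace NCSeries

/-! ## 1. Substitution endomorphisms -/

section Subst

variable {α : Type u} [Fintype α] {R : Type v} [CommRing R]

/-- The **substitution endomorphism** `φ ↦ φ(f)` of `R⟨⟨A⟩⟩` determined by letter images
`f : A → R⟨⟨A⟩⟩`: `c_u(subst f φ) = c_u(evalTrunc |u| f φ)`, i.e. the image of the
weight-`≤ |u|` part of `φ` under `x_a ↦ f a`, read in the coefficient of `u` (for
constant-term-free `f a` the longer words of `φ` cannot contribute there).  The continuous algebra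
endomorphisms of the completed free algebra are exactly these substitutions.
[cite: Reutenauer1993, §1.4] -/
def subst (f : α → NCSeries α R) (φ : NCSeries α R) : NCSeries α R :=
  fun u => evalTrunc u.length f φ u

variable {f : α → NCSeries α R}

/-- The coefficients of a substitution. [cite: Reutenauer1993, §1.4] -/
theorem subst_apply (φ : NCSeries α R) (u : List α) :
    subst f φ u = evalTrunc u.length f φ u := rfl

/-- Additivity of substitution. [folklore] -/
theorem subst_add (φ ψ : NCSeries α R) : subst f (φ + ψ) = subst f φ + subst f ψ := by
  funext u
  rw [add_apply, subst_apply, subst_apply, subst_apply, evalTrunc_add, add_apply]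

/-- `subst f 1 = 1`. [folklore] -/
theorem subst_one : subst f 1 = 1 := by
  funext u
  rw [subst_apply, evalTrunc_one]

omit [Fintype α] in
/-- A product of more constant-term-free series than the length of a word vanishes on it.
[folklore] -/
theorem prod_map_apply_eq_zero (hf : ∀ a, f a [] = 0) {w u : List α} (h : u.length < w.length) :
    (w.map f).prod u = 0 :=
  list_prod_apply_eq_zero (w.map f) (fun S hS => by
    obtain ⟨a, -, rfl⟩ := List.mem_map.mp hS; exact hf a) u (by simpa using h)

variable [DecidableEq α]

/-- The coefficients of the weight-truncated substitution:
`c_u(evalTrunc N f φ) = Σ_{|w| ≤ N} c_w(φ) c_u(f(w₁)⋯f(w_k))`. [folklore] -/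
theorem evalTrunc_apply (N : ℕ) (φ : NCSeries α R) (u : List α) :
    evalTrunc N f φ u = ∑ w ∈ wordsLE α N, φ w * (w.map f).prod u := by
  rw [evalTrunc_eq_sum_wordsLE, finset_sum_apply]
  rfl

/-- Raising the truncation order beyond the length of the word read does not change the
coefficient, for constant-term-free letter images. [folklore] -/
theorem evalTrunc_apply_of_le (hf : ∀ a, f a [] = 0) {N : ℕ} {u : List α} (hu : u.length ≤ N)
    (φ : NCSeries α R) : evalTrunc N f φ u = evalTrunc u.length f φ u := by
  rw [evalTrunc_apply, evalTrunc_apply]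
  symm
  refine Finset.sum_subset (fun w hw => ?_) fun w _ hwu => ?_
  · rw [mem_wordsLE] at hw ⊢; omega
  · rw [mem_wordsLE, not_le] at hwu
    rw [prod_map_apply_eq_zero hf hwu, mul_zero]

/-- Homogeneity of substitution. [folklore] -/
theorem subst_smul (r : R) (φ : NCSeries α R) : subst f (r • φ) = r • subst f φ := by
  funext u
  rw [smul_apply, subst_apply, subst_apply, evalTrunc_smul, smul_apply]

/-- `subst f 0 = 0`. [folklore] -/
theorem subst_zero : subst f 0 = 0 := by
  funext u
  rw [subst_apply, evalTrunc_apply, zero_apply]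
  exact Finset.sum_eq_zero fun w _ => by rw [zero_apply, zero_mul]

/-- `subst f (-φ) = -subst f φ`. [folklore] -/
theorem subst_neg (φ : NCSeries α R) : subst f (-φ) = -subst f φ := by
  have h := subst_add (f := f) (-φ) φ
  rw [neg_add_cancel, subst_zero] at h
  exact (neg_eq_of_add_eq_zero_left h.symm).symm

/-- `subst f (φ - ψ) = subst f φ - subst f ψ`. [folklore] -/
theorem subst_sub (φ ψ : NCSeries α R) : subst f (φ - ψ) = subst f φ - subst f ψ := by
  rw [sub_eq_add_neg, subst_add, subst_neg, ← sub_eq_add_neg]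

/-- Substitution through finite sums. [folklore] -/
theorem subst_finset_sum {ι : Type*} (s : Finset ι) (g : ι → NCSeries α R) :
    subst f (∑ i ∈ s, g i) = ∑ i ∈ s, subst f (g i) := by
  funext u
  rw [subst_apply, evalTrunc_finset_sum, finset_sum_apply, finset_sum_apply]
  rfl

/-- **Monomials go to products of letter images**: `subst f (r·w) = r · f(w₁) ⋯ f(w_k)`.
[cite: Reutenauer1993, §1.4] -/
theorem subst_monomial (hf : ∀ a, f a [] = 0) (w : List α) (r : R) :
    subst f (monomial w r) = r • (w.map f).prod := by
  funext u
  rw [smul_apply, smul_eq_mul, subst_apply, evalTrunc_apply]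
  by_cases hw : w.length ≤ u.length
  · rw [Finset.sum_eq_single_of_mem w (mem_wordsLE.mpr hw) fun w' _ hne => by
      rw [monomial_apply, if_neg hne, zero_mul]]
    rw [monomial_apply, if_pos rfl]
  · rw [Finset.sum_eq_zero fun w' hw' => ?_, prod_map_apply_eq_zero hf (not_le.mp hw), mul_zero]
    rw [monomial_apply]
    split_ifs with h
    · subst h; exact absurd (mem_wordsLE.mp hw') hw
    · rw [zero_mul]

/-- **Letters go to their images**: `subst f x_a = f a`. [cite: Reutenauer1993, §1.4] -/
theorem subst_letter (hf : ∀ a, f a [] = 0) (a : α) : subst f (letter a) = f a := by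
  rw [show (letter a : NCSeries α R) = monomial [a] 1 from rfl, subst_monomial hf, one_smul,
    List.map_singleton, List.prod_singleton]

/-- The constant term is unchanged by substitution. [folklore] -/
theorem subst_apply_nil (φ : NCSeries α R) : subst f φ [] = φ [] := by
  rw [subst_apply, evalTrunc_apply,
    Finset.sum_eq_single_of_mem ([] : List α) (mem_wordsLE.mpr le_rfl) fun w hw hne => ?_]
  · rw [List.map_nil, List.prod_nil, one_apply_nil, mul_one]
  · rw [mem_wordsLE, List.length_nil, Nat.le_zero, List.length_eq_zero_iff] at hw
    exact absurd hw hne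

/-- **Substitution is multiplicative** when the letter images have no constant term:
`(φ ψ)(f) = φ(f) ψ(f)` — proved in the truncated algebras `R⟨⟨A⟩⟩/(deg > N)`, where
the truncated substitution is an algebra map (`NCSeries.evalTrunc_mul`).
[cite: Reutenauer1993, §1.4] -/
theorem subst_mul (hf : ∀ a, f a [] = 0) (φ ψ : NCSeries α R) :
    subst f (φ * ψ) = subst f φ * subst f ψ := by
  funext u
  set N := u.length with hN
  have key : Ideal.Quotient.mk (truncIdeal α R N) (evalTrunc N f (φ * ψ)) =
      Ideal.Quotient.mk (truncIdeal α R N) (evalTrunc N f φ * evalTrunc N f ψ) := by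
    have h1 := algHom_evalTrunc (Ideal.Quotient.mkₐ R (truncIdeal α R N)) N f
    simp only [Ideal.Quotient.mkₐ_eq_mk] at h1
    rw [map_mul, h1, h1, h1]
    refine evalTrunc_mul N _ (fun w hw => ?_) φ ψ
    rw [← List.map_map, ← map_list_prod]
    exact mk_list_prod_eq_zero (w.map f) (fun S hS => by
      obtain ⟨a, -, rfl⟩ := List.mem_map.mp hS; exact hf a) (by simpa using hw)
  have hu := (mk_eq_mk_iff.mp key) u le_rfl
  rw [subst_apply, mul_apply, ← hN, hu, mul_apply]
  refine Finset.sum_congr rfl fun p hp => ?_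
  have hl := congrArg List.length (mem_splits.mp hp)
  rw [List.length_append] at hl
  rw [subst_apply, subst_apply, evalTrunc_apply_of_le hf (show p.1.length ≤ N by omega),
    evalTrunc_apply_of_le hf (show p.2.length ≤ N by omega)]

/-- Powers: `(φ^m)(f) = φ(f)^m`. [folklore] -/
theorem subst_pow (hf : ∀ a, f a [] = 0) (φ : NCSeries α R) :
    ∀ m : ℕ, subst f (φ ^ m) = subst f φ ^ m
  | 0 => by rw [pow_zero, pow_zero]; exact subst_one
  | m + 1 => by rw [pow_succ, pow_succ, subst_mul hf, subst_pow hf φ m]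

/-- List products: `(Π φᵢ)(f) = Π φᵢ(f)`. [folklore] -/
theorem subst_list_prod (hf : ∀ a, f a [] = 0) :
    ∀ L : List (NCSeries α R), subst f L.prod = (L.map (subst f)).prod
  | [] => by rw [List.prod_nil, List.map_nil, List.prod_nil]; exact subst_one
  | φ :: L => by
    rw [List.prod_cons, List.map_cons, List.prod_cons, subst_mul hf, subst_list_prod hf L]

omit [Fintype α] in
/-- `(a w)·1 = x_a (w·1)`. [folklore] -/
theorem monomial_cons_eq_letter_mul (a : α) (w : List α) :
    (monomial (a :: w) 1 : NCSeries α R) = letter a * monomial w 1 := by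
  rw [letter, monomial_mul_monomial, one_mul, List.singleton_append]

omit [Fintype α] in
/-- `(aⁿ)·1 = x_aⁿ`. [folklore] -/
theorem monomial_replicate_eq_pow (a : α) : ∀ n : ℕ,
    (monomial (List.replicate n a) 1 : NCSeries α R) = letter a ^ n
  | 0 => by rw [List.replicate_zero, monomial_nil_one, pow_zero]
  | n + 1 => by
    rw [List.replicate_succ, monomial_cons_eq_letter_mul, monomial_replicate_eq_pow a n, pow_succ']

/-- Substitution into `(a w)·1`. [folklore] -/
theorem subst_monomial_cons (hf : ∀ a, f a [] = 0) (a : α) (w : List α) :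
    subst f (monomial (a :: w) 1) = f a * subst f (monomial w 1) := by
  rw [monomial_cons_eq_letter_mul, subst_mul hf, subst_letter hf]

/-- Substitution into a concatenation `(u v)·1`. [folklore] -/
theorem subst_monomial_append (hf : ∀ a, f a [] = 0) (u v : List α) :
    subst f (monomial (u ++ v) 1) = subst f (monomial u 1) * subst f (monomial v 1) := by
  rw [show (monomial (u ++ v) 1 : NCSeries α R) = monomial u 1 * monomial v 1 by
    rw [monomial_mul_monomial, one_mul], subst_mul hf]

/-- Substitution into a pure power `(aⁿ)·1`. [folklore] -/
theorem subst_monomial_replicate (hf : ∀ a, f a [] = 0) (a : α) (n : ℕ) :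
    subst f (monomial (List.replicate n a) 1) = f a ^ n := by
  rw [monomial_replicate_eq_pow, subst_pow hf, subst_letter hf]

/-- **Truncation-continuity**: `c_u(φ(f))` only reads the coefficients of `φ` in weight `≤ |u|`.
[cite: Reutenauer1993, §1.4] -/
theorem subst_apply_congr {φ ψ : NCSeries α R} {u : List α}
    (h : ∀ w : List α, w.length ≤ u.length → φ w = ψ w) : subst f φ u = subst f ψ u := by
  rw [subst_apply, subst_apply, evalTrunc_congr _ _ h]

omit [Fintype α] in
/-- `c_{b w}(x_a ψ) = [b = a] c_w(ψ)` (left multiplication by a letter). [folklore] -/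
theorem letter_mul_apply_cons (a b : α) (ψ : NCSeries α R) (w : List α) :
    ((letter a : NCSeries α R) * ψ) (b :: w) = if b = a then ψ w else 0 := by
  rw [mul_apply_cons, letter_apply, if_neg (by simp), zero_mul, zero_add]
  have : lderiv b (letter a : NCSeries α R) = C (if b = a then 1 else 0) := by
    funext v
    rw [lderiv_apply, letter_apply]
    cases v with
    | nil => by_cases hb : b = a <;> simp [hb]
    | cons d v => simp
  rw [this, C_mul_apply]
  split_ifs <;> simp

omit [Fintype α] [DecidableEq α] in
/-- `c_∅(x_a ψ) = 0`. [folklore] -/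
theorem letter_mul_apply_nil [DecidableEq α] (a : α) (ψ : NCSeries α R) :
    ((letter a : NCSeries α R) * ψ) [] = 0 := by
  rw [mul_apply_nil', letter_apply, if_neg (by simp), zero_mul]

omit [Fintype α] in
/-- `c_w(ψ x_a) = [w ends with a] c_{w minus its last letter}(ψ)` (right multiplication by a
letter). [folklore] -/
theorem mul_letter_apply (a : α) (ψ : NCSeries α R) (w : List α) :
    (ψ * (letter a : NCSeries α R)) w = if w.getLast? = some a then ψ w.dropLast else 0 := by
  rw [mul_apply]
  by_cases h : w.getLast? = some a
  · rw [if_pos h]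
    have hw : w.dropLast ++ [a] = w := by
      rw [List.getLast?_eq_some_iff] at h
      obtain ⟨v, rfl⟩ := h
      rw [List.dropLast_concat]
    rw [Finset.sum_eq_single_of_mem (w.dropLast, [a]) (mem_splits.mpr hw)]
    · rw [letter_apply, if_pos rfl, mul_one]
    · rintro ⟨u, v⟩ hp hne
      rw [mem_splits] at hp
      rw [letter_apply]
      split_ifs with hv
      · subst hv
        exfalso
        apply hne
        have hu : u = w.dropLast := by rw [← hp, List.dropLast_concat]
        rw [hu]
      · rw [mul_zero]
  · rw [if_neg h]
    refine Finset.sum_eq_zero ?_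
    rintro ⟨u, v⟩ hp
    rw [mem_splits] at hp
    rw [letter_apply]
    split_ifs with hv
    · subst hv
      exact absurd (by rw [← hp, List.getLast?_append]; rfl) h
    · rw [mul_zero]

omit [Fintype α] in
/-- `c_{w a}(ψ x_b) = [a = b] c_w(ψ)`. [folklore] -/
theorem mul_letter_apply_concat (a b : α) (ψ : NCSeries α R) (w : List α) :
    (ψ * (letter b : NCSeries α R)) (w ++ [a]) = if a = b then ψ w else 0 := by
  rw [mul_letter_apply, List.getLast?_concat, List.dropLast_concat]
  by_cases h : a = b
  · subst h; simp
  · rw [if_neg h, if_neg (by simpa using h)]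

omit [Fintype α] in
/-- `c_∅(ψ x_a) = 0`. [folklore] -/
theorem mul_letter_apply_nil (a : α) (ψ : NCSeries α R) :
    (ψ * (letter a : NCSeries α R)) [] = 0 := by
  rw [mul_apply_nil', letter_apply, if_neg (by simp), mul_zero]

end Subst

/-! ## 2. The anti-involution "reverse and relabel" -/

section Dual

variable {α : Type u} {R : Type v}

/-- **Reverse-and-relabel**: `c_v(dualSeries e φ) = c_{(e v) reversed}(φ)`.  For `α = Bool`,
`e = not` this is the duality involution `τ` (interchange `x ↔ y` and reverse the word) of
[IharaKanekoZagier2006, §6], an anti-automorphism of `𝔥`.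
[cite: IharaKanekoZagier2006, §6 (τ)] -/
def dualSeries (e : α → α) (φ : NCSeries α R) : NCSeries α R :=
  fun v => φ ((v.reverse).map e)

/-- Coefficients of `dualSeries`. [cite: IharaKanekoZagier2006, §6 (τ)] -/
@[simp] theorem dualSeries_apply (e : α → α) (φ : NCSeries α R) (v : List α) :
    dualSeries e φ v = φ ((v.reverse).map e) := rfl

/-- `dualSeries` is additive. [folklore] -/
theorem dualSeries_add [AddCommMonoid R] (e : α → α) (φ ψ : NCSeries α R) :
    dualSeries e (φ + ψ) = dualSeries e φ + dualSeries e ψ := rfl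

/-- `dualSeries` is homogeneous. [folklore] -/
theorem dualSeries_smul [Semiring R] (e : α → α) (r : R) (φ : NCSeries α R) :
    dualSeries e (r • φ) = r • dualSeries e φ := rfl

/-- `dualSeries` for an involution `e` is an involution. [folklore] -/
theorem dualSeries_dualSeries {e : α → α} (he : Function.Involutive e) (φ : NCSeries α R) :
    dualSeries e (dualSeries e φ) = φ := by
  funext v
  simp [List.map_reverse, List.map_map, he.comp_self]

/-- **`dualSeries` is an anti-endomorphism** (over a commutative coefficient ring):
`τ(φ ψ) = τ(ψ) τ(φ)` — a deconcatenation of the reversed word is a reversed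
deconcatenation.
[cite: IharaKanekoZagier2006, §6 (τ anti-automorphism)] -/
theorem dualSeries_mul [CommSemiring R] (e : α → α) (φ ψ : NCSeries α R) :
    dualSeries e (φ * ψ) = dualSeries e ψ * dualSeries e φ := by
  funext v
  rw [dualSeries_apply, mul_apply, mul_apply]
  symm
  refine Finset.sum_nbij' (fun q => (((q.2).map e).reverse, ((q.1).map e).reverse))
    (fun p => (v.take p.2.length, v.drop p.2.length)) ?_ ?_ ?_ ?_ ?_
  · rintro ⟨c, d⟩ hq
    rw [mem_splits] at hq ⊢
    dsimp only
    rw [← hq, List.reverse_append, List.map_append, List.map_reverse, List.map_reverse]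
  · rintro ⟨a, b⟩ _
    exact mem_splits.mpr (List.take_append_drop _ _)
  · rintro ⟨c, d⟩ hq
    rw [mem_splits] at hq
    dsimp only
    rw [List.length_reverse, List.length_map, ← hq, List.take_left, List.drop_left]
  · rintro ⟨a, b⟩ hp
    rw [mem_splits] at hp
    dsimp only at hp ⊢
    have hlen : a.length + b.length = v.length := by
      have := congrArg List.length hp
      rw [List.length_append, List.length_map, List.length_reverse] at this
      exact this
    have hsplit : ((v.drop b.length).map e).reverse ++ ((v.take b.length).map e).reverse =
        (v.reverse).map e := by
      conv_rhs => rw [← List.take_append_drop b.length v]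
      rw [List.reverse_append, List.map_append, List.map_reverse, List.map_reverse]
    rw [← hp] at hsplit
    have hl : ((v.drop b.length).map e).reverse.length = a.length := by
      rw [List.length_reverse, List.length_map, List.length_drop]
      omega
    obtain ⟨h1, h2⟩ := List.append_inj hsplit hl
    rw [h1, h2]
  · rintro ⟨c, d⟩ _
    dsimp only
    rw [dualSeries_apply, dualSeries_apply, mul_comm, List.map_reverse, List.map_reverse]

end Dual

end NCSeries

end Literature.NumberTheory.Transcendental
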